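import Summits.PneNP.PneNP.Theorems.ChebyshevTracialDesignFreeBinning
import Summits.PneNP.PneNP.Theorems.ChebyshevTracialDesignNowhereZeroPadding
import HarnessLib

/-!
# Cell pnp-psdrank, route `ChebyshevTracialDesign`: TIGHTNESS-FREE TRACIAL DECAY AT EVERY BOUNDED DIMENSION — UNCONDITIONAL
# (crux `TracialDecayExp20`, stmt-PneNP-19878)

Brick 85b (prover g15; MEMO-18 §2(c)). Brick 85 (`…FreeBinning.free_value_binned_le_exp`) bounds the design value of ANY pair of contraction
families by `20·|ι|·e^{−a·dq n} + 20·η` per unit dimension, for any partition of the matching side into `|ι|` operator-norm bins of radius `η`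
(NTF, unconditional). Here the bins are made explicit — round every entry of `Y_M` to the grid `(1/N)·ℤ ∩ [−1,1]` (§2; a psd contraction has
entries in `[−1,1]`, §1), and re-normalise the grid point into a psd contraction (§3, explicit expressions, no definitions): `|ι| = (2N+1)^{r·r}`,
`η = 2r/N` — so that
(§4, **`free_value_le_grid`**) for all large even `n`, every balanced design, EVERY `r ≥ 1`, every `N ≥ 1` and every pair of contraction
families of dimension `r` (no orthogonality on the tight pairs):

  `(1/r)·Σ W·tr(X_U Y_M) ≤ 20·(2N+1)^{r·r}·exp(−a·dq n) + 40·r/N`,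

and hence (§5, **`free_tracialDecay_boundedDim`**) for every `r₀` there are `a' > 0` (`= a/(4r₀²)`) and `n₁` with: for all even `n ≥ n₁`, every
balanced `B = 20` design, every `1 ≤ r ≤ r₀` and ALL contraction families `X, Y` of dimension `r`, `(1/r)·Σ W·tr(X_U Y_M) ≤ exp(−a'·dq n)`.
This is the tightness-free twin of `…UnconditionalRungs.tracialDecayExp_boundedDim_holds` (tight pairs, rate `a/(8(r₀+1))`, block-lift nets):
NOT implied by it (brick 84's equivalence trades untight dimension `r` for tight dimension `≈ n²·r`), unconditional, and three ideas long
(NTF + binning + rounding). With bricks 84/85 the free-world ladder now reads: `r = 1` = NTF (proved) · bounded `r` = this file (proved, rate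
`≍ a/r²`) · all `r < e^{a·dq n/2}` with ONE rate = the crux (open) — the open content of `TracialDecayExp20` is `r`-UNIFORMITY and nothing else.
[cite: Rothvoss2017, §2 (PDF pp. 6–8)] [cite: BrietDadushPokutta2014, Thm. 6 (§3)] [cite: KeevashLifshitz2023, Thm. 1.8]
Stature: support/instrument (an unconditional bounded-dimension statement; the rate degrades like `1/r₀²`). WHAT THIS IS NOT: no `r`-uniform
bound, nothing on psd rank of P_PM(K_n), no P-vs-NP content.
-/

set_option linter.dupNamespace false -- `Summit.PneNP.PneNP.…`: summit = sub-problem (D-0017)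

noncomputable section

namespace Summit.PneNP.PneNP.Theorems.ChebyshevTracialDesignFreeBoundedDimension

open Finset Matrix Literature.Barriers.PneNP Literature.Combinatorics.Optimization
open Summit.PneNP.PneNP.Theorems.ChebyshevTracialDesignFreeBinning
open Summit.PneNP.PneNP.Theorems.ChebyshevTracialDesignNowhereZeroPadding (exists_mul_pow_le_exp)
open Summit.PneNP.PneNP.Theorems.ChebyshevTracialDesignBoundedDim (le_dq_of_pow_le)

variable {r : ℕ}

/-! ### §1 Entries of a psd contraction lie in `[−1, 1]`; operator-norm bounds from entry bounds -/

/-- The quadratic form of a real matrix at `a·e_i + b·e_j`. -/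
theorem quadForm_single_add_single (Y : Matrix (Fin r) (Fin r) ℝ) (i j : Fin r) (a b : ℝ) :
    (Pi.single i a + Pi.single j b) ⬝ᵥ (Y *ᵥ (Pi.single i a + Pi.single j b)) =
      a * a * Y i i + a * b * Y i j + b * a * Y j i + b * b * Y j j := by
  rw [mulVec_add, mulVec_single, mulVec_single, add_dotProduct, dotProduct_add, dotProduct_add]
  simp only [single_dotProduct, Pi.smul_apply, op_smul_eq_mul, Matrix.col_apply]
  ring

/-- **Entries of a psd contraction are bounded by one**: `0 ⪯ Y ⪯ I ⇒ |Y i j| ≤ 1` (quadratic form at `e_i ± e_j`).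
[cite: BrietDadushPokutta2014, Thm. 6 (§3)] -/
theorem abs_entry_le_one {Y : Matrix (Fin r) (Fin r) ℝ} (hY : Y.PosSemidef ∧ (1 - Y).PosSemidef) (i j : Fin r) : |Y i j| ≤ 1 := by
  have hsym : Y j i = Y i j := by
    have h := hY.1.1.apply j i
    simpa using h.symm
  -- quadratic forms of `Y` and `1 - Y` at `e_i + s e_j`
  have hq : ∀ s : ℝ, 0 ≤ 1 * 1 * Y i i + 1 * s * Y i j + s * 1 * Y i j + s * s * Y j j ∧
      0 ≤ 1 * 1 * (1 - Y i i) + 1 * s * ((if i = j then 1 else 0) - Y i j) + s * 1 * ((if j = i then 1 else 0) - Y i j) +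
        s * s * (1 - Y j j) := by
    intro s
    have h0 := hY.1.dotProduct_mulVec_nonneg (Pi.single i 1 + Pi.single j s)
    have h1 := hY.2.dotProduct_mulVec_nonneg (Pi.single i 1 + Pi.single j s)
    rw [star_trivial, quadForm_single_add_single] at h0 h1
    simp only [Matrix.sub_apply, Matrix.one_apply_eq, Matrix.one_apply] at h1
    rw [hsym] at h0 h1
    exact ⟨h0, h1⟩
  obtain ⟨hp0, hp1⟩ := hq 1
  obtain ⟨hm0, hm1⟩ := hq (-1)
  rw [abs_le]
  by_cases hij : i = j
  · subst hij
    simp only [if_true] at hp1 hm1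
    constructor <;> nlinarith [hp0, hp1, hm0, hm1]
  · have hji : ¬ j = i := fun h => hij h.symm
    rw [if_neg hij, if_neg hji] at hp1 hm1
    constructor <;> nlinarith [hp0, hp1, hm0, hm1]

/-- **Operator norm from an entry bound**: a symmetric `E` with `|E i j| ≤ δ` satisfies `−rδ·I ⪯ E ⪯ rδ·I`
(`|xᵀEx| ≤ δ(Σ|x_i|)² ≤ δ·r·|x|²`). -/
theorem opBound_of_entry_bound {E : Matrix (Fin r) (Fin r) ℝ} (hE : E.IsHermitian) {δ : ℝ} (hδ0 : 0 ≤ δ) (hδ : ∀ i j, |E i j| ≤ δ) :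
    (((r : ℝ) * δ) • (1 : Matrix (Fin r) (Fin r) ℝ) - E).PosSemidef ∧ (((r : ℝ) * δ) • (1 : Matrix (Fin r) (Fin r) ℝ) + E).PosSemidef := by
  have hquad : ∀ x : Fin r → ℝ, |x ⬝ᵥ (E *ᵥ x)| ≤ (r : ℝ) * δ * (x ⬝ᵥ x) := by
    intro x
    calc |x ⬝ᵥ (E *ᵥ x)| = |∑ i, ∑ j, x i * E i j * x j| := by
          congr 1; simp only [dotProduct, mulVec, Finset.mul_sum]; exact Finset.sum_congr rfl fun i _ => Finset.sum_congr rfl fun j _ => by ring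
      _ ≤ ∑ i, ∑ j, |x i| * δ * |x j| := by
          refine (abs_sum_le_sum_abs _ _).trans (sum_le_sum fun i _ => (abs_sum_le_sum_abs _ _).trans (sum_le_sum fun j _ => ?_))
          rw [abs_mul, abs_mul]
          exact mul_le_mul_of_nonneg_right (mul_le_mul_of_nonneg_left (hδ i j) (abs_nonneg _)) (abs_nonneg _)
      _ = δ * (∑ i, |x i| * 1) ^ 2 := by
          rw [sq, Finset.sum_mul_sum, Finset.mul_sum]
          exact Finset.sum_congr rfl fun i _ => by rw [Finset.mul_sum]; exact Finset.sum_congr rfl fun j _ => by ring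
      _ ≤ δ * ((∑ i, |x i| ^ 2) * (∑ _i : Fin r, (1 : ℝ) ^ 2)) := mul_le_mul_of_nonneg_left (Finset.sum_mul_sq_le_sq_mul_sq _ _ _) hδ0
      _ = (r : ℝ) * δ * (x ⬝ᵥ x) := by
          have e1 : ∑ _i : Fin r, (1 : ℝ) ^ 2 = r := by simp
          have e2 : ∑ i, |x i| ^ 2 = x ⬝ᵥ x := Finset.sum_congr rfl fun i _ => by rw [sq_abs, sq]
          rw [e1, e2]; ring
  have h1 : (((r : ℝ) * δ) • (1 : Matrix (Fin r) (Fin r) ℝ)).IsHermitian := by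
    rw [IsHermitian, conjTranspose_smul, star_trivial, conjTranspose_one]
  constructor
  · refine PosSemidef.of_dotProduct_mulVec_nonneg (h1.sub hE) fun x => ?_
    rw [star_trivial, sub_mulVec, dotProduct_sub, smul_mulVec, one_mulVec, dotProduct_smul, smul_eq_mul]
    have := (abs_le.1 (hquad x)).2
    linarith
  · refine PosSemidef.of_dotProduct_mulVec_nonneg (h1.add hE) fun x => ?_
    rw [star_trivial, add_mulVec, dotProduct_add, smul_mulVec, one_mulVec, dotProduct_smul, smul_eq_mul]
    have := (abs_le.1 (hquad x)).1
    linarith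


/-! ### §2 Rounding to the grid `(1/N)ℤ ∩ [−1, 1]` -/

/-- The grid index of a real in `[−1,1]` at resolution `N ≥ 1` lies in `[−N, N]`. -/
theorem floor_mem_Icc {y : ℝ} (hy : |y| ≤ 1) {N : ℕ} (hN : 0 < N) : ⌊y * N⌋ ∈ Finset.Icc (-(N : ℤ)) N := by
  have hN' : (0 : ℝ) < N := by exact_mod_cast hN
  obtain ⟨h1, h2⟩ := abs_le.1 hy
  rw [Finset.mem_Icc]
  constructor
  · rw [Int.le_floor]; push_cast; nlinarith
  · have : (⌊y * N⌋ : ℝ) ≤ N := (Int.floor_le _).trans (by nlinarith)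
    exact_mod_cast this

/-- Rounding error: `|y − ⌊yN⌋/N| ≤ 1/N`. -/
theorem abs_sub_floor_div_le (y : ℝ) {N : ℕ} (hN : 0 < N) : |y - (⌊y * N⌋ : ℝ) / N| ≤ 1 / N := by
  have hN' : (0 : ℝ) < N := by exact_mod_cast hN
  have h1 := Int.floor_le (y * N)
  have h2 := Int.lt_floor_add_one (y * N)
  have heq : y - (⌊y * N⌋ : ℝ) / N = (y * N - ⌊y * N⌋) / N := by field_simp
  rw [heq, abs_div, abs_of_pos hN']
  refine div_le_div_of_nonneg_right ?_ hN'.le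
  rw [abs_le]; constructor <;> linarith

/-! ### §3 The grid net of the psd contractions of dimension `r` (no definitions: explicit expressions) -/

/-- The number of `r × r` arrays of grid indices in `[−N, N]` is `(2N+1)^{r·r}`. -/
theorem card_grid (N : ℕ) : (Fintype.card (Fin r → Fin r → (Finset.Icc (-(N : ℤ)) (N : ℤ))) : ℝ) = ((2 * N + 1 : ℕ) : ℝ) ^ (r * r) := by
  have h1 : Fintype.card (Finset.Icc (-(N : ℤ)) (N : ℤ)) = 2 * N + 1 := by
    rw [Fintype.card_coe, Int.card_Icc]; omega
  have h2 : Fintype.card (Fin r → Fin r → (Finset.Icc (-(N : ℤ)) (N : ℤ))) = (2 * N + 1) ^ (r * r) := by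
    rw [Fintype.card_fun, Fintype.card_fun, Fintype.card_fin, h1, ← pow_mul, mul_comm]
  rw [h2]; push_cast; ring

/-- **The rounded-and-renormalised grid point of a psd contraction.** For a psd contraction `Y` of dimension `r` and `N ≥ 1`, let `G` be `Y` with
every entry rounded down to the grid `(1/N)ℤ` and `R := (1+2δ)⁻¹·(G + δ·I)`, `δ = r/N`. Then `R` is a psd contraction and
`−2δ·I ⪯ Y − R ⪯ 2δ·I` (the rounding error `E = Y − G` is symmetric with entries `≤ 1/N`, hence `−δI ⪯ E ⪯ δI` by §1).
[cite: BrietDadushPokutta2014, Thm. 6 (§3)] -/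
theorem grid_spec {N : ℕ} (hN : 0 < N) {Y : Matrix (Fin r) (Fin r) ℝ} (hY : Y.PosSemidef ∧ (1 - Y).PosSemidef) :
    ((1 + 2 * ((r : ℝ) / N))⁻¹ • ((Matrix.of fun i j : Fin r => (⌊Y i j * N⌋ : ℝ) / N) + ((r : ℝ) / N) • (1 : Matrix (Fin r) (Fin r) ℝ))).PosSemidef ∧
    (1 - (1 + 2 * ((r : ℝ) / N))⁻¹ • ((Matrix.of fun i j : Fin r => (⌊Y i j * N⌋ : ℝ) / N) + ((r : ℝ) / N) • (1 : Matrix (Fin r) (Fin r) ℝ))).PosSemidef ∧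
    ((2 * ((r : ℝ) / N)) • (1 : Matrix (Fin r) (Fin r) ℝ) -
      (Y - (1 + 2 * ((r : ℝ) / N))⁻¹ • ((Matrix.of fun i j : Fin r => (⌊Y i j * N⌋ : ℝ) / N) + ((r : ℝ) / N) • (1 : Matrix (Fin r) (Fin r) ℝ)))).PosSemidef ∧
    ((2 * ((r : ℝ) / N)) • (1 : Matrix (Fin r) (Fin r) ℝ) +
      (Y - (1 + 2 * ((r : ℝ) / N))⁻¹ • ((Matrix.of fun i j : Fin r => (⌊Y i j * N⌋ : ℝ) / N) + ((r : ℝ) / N) • (1 : Matrix (Fin r) (Fin r) ℝ)))).PosSemidef := by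
  have hN' : (0 : ℝ) < N := by exact_mod_cast hN
  set δ : ℝ := (r : ℝ) / N with hδ
  have hδ0 : 0 ≤ δ := by positivity
  set c : ℝ := (1 + 2 * δ)⁻¹ with hc
  have hc0 : 0 ≤ c := by rw [hc]; positivity
  have hc1 : c * (1 + 2 * δ) = 1 := by rw [hc]; exact inv_mul_cancel₀ (by positivity)
  set G : Matrix (Fin r) (Fin r) ℝ := Matrix.of fun i j : Fin r => (⌊Y i j * N⌋ : ℝ) / N with hG
  set E := Y - G with hE
  -- the rounding error is entrywise `≤ 1/N`, symmetric
  have hEsym : E.IsHermitian := by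
    have hYs : ∀ i j, Y j i = Y i j := fun i j => by simpa using (hY.1.1.apply j i).symm
    rw [IsHermitian]; ext i j
    rw [conjTranspose_apply, star_trivial, hE, Matrix.sub_apply, Matrix.sub_apply, hG, Matrix.of_apply, Matrix.of_apply, hYs i j]
  have hEb : ∀ i j, |E i j| ≤ 1 / N := fun i j => by
    rw [hE, Matrix.sub_apply, hG, Matrix.of_apply]
    exact abs_sub_floor_div_le _ hN
  have hop := opBound_of_entry_bound hEsym (by positivity) hEb
  rw [show (r : ℝ) * (1 / N) = δ by rw [hδ]; ring] at hop
  -- `(1+2δ)⁻¹ (G + δ I)` is a psd contraction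
  have hA : (c • (G + δ • (1 : Matrix (Fin r) (Fin r) ℝ))).PosSemidef := by
    have h : G + δ • (1 : Matrix (Fin r) (Fin r) ℝ) = Y + (δ • 1 - E) := by rw [hE]; abel
    rw [h]; exact (hY.1.add hop.1).smul hc0
  have hB : (1 - c • (G + δ • (1 : Matrix (Fin r) (Fin r) ℝ))).PosSemidef := by
    have h : 1 - c • (G + δ • (1 : Matrix (Fin r) (Fin r) ℝ)) = c • ((1 - Y) + (δ • 1 + E)) := by
      rw [hE]
      ext i j
      simp only [Matrix.sub_apply, Matrix.add_apply, Matrix.smul_apply, Matrix.one_apply, smul_eq_mul]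
      split_ifs
      · linear_combination (-1 : ℝ) * hc1
      · ring
    rw [h]; exact (hY.2.add hop.2).smul hc0
  refine ⟨hA, hB, ?_, ?_⟩
  · have h : (2 * δ) • (1 : Matrix (Fin r) (Fin r) ℝ) - (Y - c • (G + δ • 1)) =
        c • ((δ • 1 - E) + (2 * δ) • (1 - Y) + (4 * δ ^ 2) • (1 : Matrix (Fin r) (Fin r) ℝ)) := by
      rw [hE]
      ext i j
      simp only [Matrix.sub_apply, Matrix.add_apply, Matrix.smul_apply, Matrix.one_apply, smul_eq_mul]
      split_ifs
      · linear_combination (Y i j - 2 * δ) * hc1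
      · linear_combination (Y i j) * hc1
    rw [h]
    exact ((hop.1.add (hY.2.smul (by positivity))).add (PosSemidef.one.smul (by positivity))).smul hc0
  · have h : (2 * δ) • (1 : Matrix (Fin r) (Fin r) ℝ) + (Y - c • (G + δ • 1)) =
        c • ((δ • 1 + E) + (2 * δ) • Y + (4 * δ ^ 2) • (1 : Matrix (Fin r) (Fin r) ℝ)) := by
      rw [hE]
      ext i j
      simp only [Matrix.sub_apply, Matrix.add_apply, Matrix.smul_apply, Matrix.one_apply, smul_eq_mul]
      split_ifs
      · linear_combination (-(2 * δ + Y i j)) * hc1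
      · linear_combination (-(Y i j)) * hc1
    rw [h]
    exact ((hop.2.add (hY.1.smul (by positivity))).add (PosSemidef.one.smul (by positivity))).smul hc0

/-! ### §4 The grid bound: every contraction pair, every dimension, every resolution -/

/-- **FREE DECAY WITH AN EXPLICIT NET — UNCONDITIONAL.** For some `a > 0` and all large even `n`: for every balanced `B = 20` design `(t, C, w)`,
EVERY `r ≥ 1`, every resolution `N ≥ 1` and ALL families of psd contractions `X_U`, `Y_M` of dimension `r` (no orthogonality on the tight pairs),
`(1/r)·Σ W·tr(X_U Y_M) ≤ 20·(2N+1)^{r·r}·exp(−a·dq n) + 40·r/N` (brick 85's binned bound on the grid net: bins = the `(2N+1)^{r·r}` arrays of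
rounded entries, references = the re-normalised grid points of §3). [cite: Rothvoss2017, §2 (PDF pp. 6–8)] [cite: BrietDadushPokutta2014, Thm. 6 (§3)]
[cite: KeevashLifshitz2023, Thm. 1.8] -/
theorem free_value_le_grid :
    ∃ a : ℝ, 0 < a ∧ ∃ n₁ : ℕ, ∀ n : ℕ, n₁ ≤ n → Even n → ∀ (t : ℕ) (C : Finset ℕ) (w : ℕ → ℝ),
      IsBalancedDesign n t (Tq n) (dq n) 20 C w → ∀ r : ℕ, 0 < r → ∀ N : ℕ, 0 < N →
        ∀ (X : OddSet n → Matrix (Fin r) (Fin r) ℝ) (Y : PMatch n → Matrix (Fin r) (Fin r) ℝ),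
          (∀ U, (X U).PosSemidef ∧ (1 - X U).PosSemidef) → (∀ M, (Y M).PosSemidef ∧ (1 - Y M).PosSemidef) →
            (∑ U, ∑ M, levelWeight n t C w U M * (X U * Y M).trace) / r ≤
              20 * ((2 * N + 1 : ℕ) : ℝ) ^ (r * r) * Real.exp (-(a * (dq n : ℝ))) + 40 * r / N := by
  classical
  obtain ⟨a, ha, n₁, h⟩ := free_value_binned_le_exp
  refine ⟨a, ha, n₁, fun n hn hev t C w hdes r hr N hN X Y hX hY => ?_⟩
  have hN' : (0 : ℝ) < N := by exact_mod_cast hN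
  have hη0 : (0 : ℝ) ≤ 2 * ((r : ℝ) / N) := by positivity
  -- bins: rounded entries; references: re-normalised grid points (or `0` when not a psd contraction)
  set b : PMatch n → (Fin r → Fin r → (Finset.Icc (-(N : ℤ)) (N : ℤ))) :=
    fun M i j => ⟨⌊Y M i j * N⌋, floor_mem_Icc (abs_entry_le_one (hY M) i j) hN⟩ with hb
  set R : (Fin r → Fin r → (Finset.Icc (-(N : ℤ)) (N : ℤ))) → Matrix (Fin r) (Fin r) ℝ :=
    fun g => (1 + 2 * ((r : ℝ) / N))⁻¹ • ((Matrix.of fun i j : Fin r => (((g i j : ℤ)) : ℝ) / N) + ((r : ℝ) / N) • (1 : Matrix (Fin r) (Fin r) ℝ))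
    with hR
  set Yref : (Fin r → Fin r → (Finset.Icc (-(N : ℤ)) (N : ℤ))) → Matrix (Fin r) (Fin r) ℝ :=
    fun g => if (R g).PosSemidef ∧ (1 - R g).PosSemidef then R g else 0 with hYref
  have hRb : ∀ M, R (b M) =
      (1 + 2 * ((r : ℝ) / N))⁻¹ • ((Matrix.of fun i j : Fin r => (⌊Y M i j * N⌋ : ℝ) / N) + ((r : ℝ) / N) • (1 : Matrix (Fin r) (Fin r) ℝ)) :=
    fun M => rfl
  have hYrefc : ∀ g, (Yref g).PosSemidef ∧ (1 - Yref g).PosSemidef := fun g => by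
    rw [hYref]; dsimp only
    split_ifs with hg
    · exact hg
    · rw [sub_zero]; exact ⟨PosSemidef.zero, PosSemidef.one⟩
  have hYb : ∀ M, Yref (b M) = R (b M) := fun M => by
    obtain ⟨h1, h2, -, -⟩ := grid_spec hN (hY M)
    rw [hYref]; dsimp only
    rw [if_pos]
    rw [hRb]; exact ⟨h1, h2⟩
  have hη : ∀ M, ((2 * ((r : ℝ) / N)) • (1 : Matrix (Fin r) (Fin r) ℝ) - (Y M - Yref (b M))).PosSemidef ∧
      ((2 * ((r : ℝ) / N)) • (1 : Matrix (Fin r) (Fin r) ℝ) + (Y M - Yref (b M))).PosSemidef := fun M => by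
    obtain ⟨-, -, h3, h4⟩ := grid_spec hN (hY M)
    rw [hYb M, hRb M]; exact ⟨h3, h4⟩
  have hbnd := h n hn hev t C w hdes r hr X Y hX (Fin r → Fin r → (Finset.Icc (-(N : ℤ)) (N : ℤ))) b Yref hYrefc
    (2 * ((r : ℝ) / N)) hη0 hη
  rw [card_grid] at hbnd
  calc (∑ U, ∑ M, levelWeight n t C w U M * (X U * Y M).trace) / r
      ≤ 20 * ((2 * N + 1 : ℕ) : ℝ) ^ (r * r) * Real.exp (-(a * (dq n : ℝ))) + 20 * (2 * ((r : ℝ) / N)) := hbnd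
    _ = 20 * ((2 * N + 1 : ℕ) : ℝ) ^ (r * r) * Real.exp (-(a * (dq n : ℝ))) + 40 * r / N := by ring

/-! ### §5 Tightness-free tracial decay at every bounded dimension -/

/-- **TIGHTNESS-FREE TRACIAL DECAY AT BOUNDED DIMENSION — UNCONDITIONAL.** For every `r₀` there are `a' > 0` and `n₁` such that for all even
`n ≥ n₁`, every balanced `B = 20` design `(t, C, w)`, every `1 ≤ r ≤ r₀` and ALL families of psd contractions `X_U`, `Y_M` of dimension `r`
(no orthogonality on the tight pairs): `(1/r)·Σ W·tr(X_U Y_M) ≤ exp(−a'·dq n)` (`a' = a/(4(r₀²+1))` with `a` the NTF rate; grid resolution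
`N ≍ r₀·e^{a'·dq n}`). The free-world twin of `…UnconditionalRungs.tracialDecayExp_boundedDim_holds`, not implied by it.
[cite: Rothvoss2017, §2 (PDF pp. 6–8)] [cite: BrietDadushPokutta2014, Thm. 6 (§3)] [cite: KeevashLifshitz2023, Thm. 1.8] -/
theorem free_tracialDecay_boundedDim (r₀ : ℕ) :
    ∃ a' : ℝ, 0 < a' ∧ ∃ n₁ : ℕ, ∀ n : ℕ, n₁ ≤ n → Even n → ∀ (t : ℕ) (C : Finset ℕ) (w : ℕ → ℝ),
      IsBalancedDesign n t (Tq n) (dq n) 20 C w → ∀ r : ℕ, 0 < r → r ≤ r₀ →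
        ∀ (X : OddSet n → Matrix (Fin r) (Fin r) ℝ) (Y : PMatch n → Matrix (Fin r) (Fin r) ℝ),
          (∀ U, (X U).PosSemidef ∧ (1 - X U).PosSemidef) → (∀ M, (Y M).PosSemidef ∧ (1 - Y M).PosSemidef) →
            (∑ U, ∑ M, levelWeight n t C w U M * (X U * Y M).trace) / r ≤ Real.exp (-(a' * (dq n : ℝ))) := by
  obtain ⟨a, ha, n₁, hgrid⟩ := free_value_le_grid
  set s : ℕ := r₀ * r₀ + 1 with hs
  have hs1 : 1 ≤ s := by omega
  have hsR : (0 : ℝ) < s := by exact_mod_cast hs1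
  set a' : ℝ := a / (4 * s) with ha'
  have ha'0 : 0 < a' := by positivity
  have ha's : a' * s = a / 4 := by rw [ha']; field_simp
  -- the constant `K = 40·(164(r₀+1))^s` is eventually below `exp((a/2)·D)`
  set K : ℝ := 40 * (164 * ((r₀ : ℝ) + 1)) ^ s with hK
  have hKpos : 0 < K := by positivity
  obtain ⟨D₀, hD₀⟩ := exists_mul_pow_le_exp (show 0 < a / 2 by positivity) hKpos 0
  refine ⟨a', ha'0, max n₁ (D₀ ^ 4), fun n hn hev t C w hdes r hr hrr X Y hX hY => ?_⟩
  have hn1 : n₁ ≤ n := le_trans (le_max_left _ _) hn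
  have hD : D₀ ≤ dq n := le_dq_of_pow_le (le_trans (le_max_right _ _) hn)
  set D : ℝ := (dq n : ℝ) with hDdef
  have hD0 : 0 ≤ D := Nat.cast_nonneg _
  -- the resolution
  set N : ℕ := ⌈80 * ((r₀ : ℝ) + 1) * Real.exp (a' * D)⌉₊ with hNdef
  have hE1 : 1 ≤ Real.exp (a' * D) := Real.one_le_exp (by positivity)
  have hNge : 80 * ((r₀ : ℝ) + 1) * Real.exp (a' * D) ≤ N := Nat.le_ceil _
  have hr0' : (1 : ℝ) ≤ (r₀ : ℝ) + 1 := by linarith [Nat.cast_nonneg (α := ℝ) r₀]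
  have hNposR : (0 : ℝ) < N := lt_of_lt_of_le (by positivity) hNge
  have hNpos : 0 < N := by exact_mod_cast hNposR
  have hNle : ((2 * N + 1 : ℕ) : ℝ) ≤ 164 * ((r₀ : ℝ) + 1) * Real.exp (a' * D) := by
    have h1 : (N : ℝ) < 80 * ((r₀ : ℝ) + 1) * Real.exp (a' * D) + 1 := Nat.ceil_lt_add_one (by positivity)
    have h2 : (3 : ℝ) ≤ 4 * ((r₀ : ℝ) + 1) * Real.exp (a' * D) := by nlinarith
    push_cast; nlinarith
  have hval := hgrid n hn1 hev t C w hdes r hr N hNpos X Y hX hY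
  -- first term: `20 (2N+1)^{r r} e^{−aD} ≤ e^{−a'D}/2`
  have hpow : ((2 * N + 1 : ℕ) : ℝ) ^ (r * r) ≤ (164 * ((r₀ : ℝ) + 1)) ^ s * Real.exp (a / 4 * D) := by
    have h1 : ((2 * N + 1 : ℕ) : ℝ) ^ (r * r) ≤ ((2 * N + 1 : ℕ) : ℝ) ^ s :=
      pow_le_pow_right₀ (by exact_mod_cast (show 1 ≤ 2 * N + 1 by omega))
        (by have := Nat.mul_le_mul hrr hrr; omega)
    refine h1.trans ?_
    calc ((2 * N + 1 : ℕ) : ℝ) ^ s ≤ (164 * ((r₀ : ℝ) + 1) * Real.exp (a' * D)) ^ s :=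
          pow_le_pow_left₀ (by positivity) hNle s
      _ = (164 * ((r₀ : ℝ) + 1)) ^ s * Real.exp (a / 4 * D) := by
          rw [mul_pow, ← Real.exp_nat_mul]
          congr 2
          rw [← mul_assoc, mul_comm (s : ℝ) a', ha's]
  have hfirst : 20 * ((2 * N + 1 : ℕ) : ℝ) ^ (r * r) * Real.exp (-(a * D)) ≤ Real.exp (-(a' * D)) / 2 := by
    have hKexp : K ≤ Real.exp (a / 2 * dq n) := by simpa using hD₀ (dq n) hD
    rw [← hDdef] at hKexp
    -- `20·(164(r₀+1))^s·e^{aD/4}·e^{−aD} = (K/2)·e^{−3aD/4} ≤ (1/2)e^{(a/2)D}e^{−3aD/4} = e^{−aD/4}/2 ≤ e^{−a'D}/2`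
    have ha'le : a' * D ≤ a / 4 * D := by
      refine mul_le_mul_of_nonneg_right ?_ hD0
      rw [ha', div_le_div_iff₀ (by positivity) (by norm_num)]
      have hs1R : (1 : ℝ) ≤ (s : ℝ) := by exact_mod_cast hs1
      nlinarith [mul_nonneg ha.le (sub_nonneg.2 hs1R)]
    have hsplit : Real.exp (a / 4 * D) * Real.exp (-(a * D)) = Real.exp (-(a / 2 * D)) * Real.exp (-(a / 4 * D)) := by
      rw [← Real.exp_add, ← Real.exp_add]; ring_nf
    have hprod : Real.exp (a / 2 * D) * Real.exp (-(a / 2 * D)) = 1 := by rw [← Real.exp_add]; simp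
    calc 20 * ((2 * N + 1 : ℕ) : ℝ) ^ (r * r) * Real.exp (-(a * D))
        ≤ 20 * ((164 * ((r₀ : ℝ) + 1)) ^ s * Real.exp (a / 4 * D)) * Real.exp (-(a * D)) := by
          gcongr
      _ = (K / 2) * (Real.exp (a / 4 * D) * Real.exp (-(a * D))) := by rw [hK]; ring
      _ ≤ (Real.exp (a / 2 * D) / 2) * (Real.exp (-(a / 2 * D)) * Real.exp (-(a / 4 * D))) := by
          rw [hsplit]; gcongr
      _ = Real.exp (-(a / 4 * D)) / 2 := by
          calc (Real.exp (a / 2 * D) / 2) * (Real.exp (-(a / 2 * D)) * Real.exp (-(a / 4 * D)))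
              = (Real.exp (a / 2 * D) * Real.exp (-(a / 2 * D))) * Real.exp (-(a / 4 * D)) / 2 := by ring
            _ = Real.exp (-(a / 4 * D)) / 2 := by rw [hprod, one_mul]
      _ ≤ Real.exp (-(a' * D)) / 2 := by gcongr
  -- second term: `40 r/N ≤ e^{−a'D}/2`
  have hsecond : 40 * (r : ℝ) / N ≤ Real.exp (-(a' * D)) / 2 := by
    have hrle : (r : ℝ) ≤ (r₀ : ℝ) + 1 := by
      have : (r : ℝ) ≤ r₀ := by exact_mod_cast hrr
      linarith
    rw [div_le_iff₀ hNposR]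
    have hE : Real.exp (-(a' * D)) * Real.exp (a' * D) = 1 := by rw [← Real.exp_add]; simp
    calc 40 * (r : ℝ) ≤ 40 * ((r₀ : ℝ) + 1) := by gcongr
      _ = Real.exp (-(a' * D)) / 2 * (80 * ((r₀ : ℝ) + 1) * Real.exp (a' * D)) := by
          calc 40 * ((r₀ : ℝ) + 1) = 40 * ((r₀ : ℝ) + 1) * (Real.exp (-(a' * D)) * Real.exp (a' * D)) := by rw [hE, mul_one]
            _ = Real.exp (-(a' * D)) / 2 * (80 * ((r₀ : ℝ) + 1) * Real.exp (a' * D)) := by ring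
      _ ≤ Real.exp (-(a' * D)) / 2 * N := mul_le_mul_of_nonneg_left hNge (by positivity)
  calc (∑ U, ∑ M, levelWeight n t C w U M * (X U * Y M).trace) / r
      ≤ 20 * ((2 * N + 1 : ℕ) : ℝ) ^ (r * r) * Real.exp (-(a * D)) + 40 * r / N := hval
    _ ≤ Real.exp (-(a' * D)) / 2 + Real.exp (-(a' * D)) / 2 := add_le_add hfirst hsecond
    _ = Real.exp (-(a' * D)) := by ring

end Summit.PneNP.PneNP.Theorems.ChebyshevTracialDesignFreeBoundedDimension

end
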